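import Mathlib
import Summits.ValiantsHypothesis.ValiantsHypothesis.Theorems.GrenetZeonTwoDimCoefficientsDefs
import Summits.ValiantsHypothesis.ValiantsHypothesis.Theorems.GrenetZeonTwoDimCoefficientsDualUnipotentNormalForm
import Summits.ValiantsHypothesis.ValiantsHypothesis.Theorems.GrenetZeonTwoDimCoefficientsScalingShadowFactor

/-!
# Crux `GrenetZeon.TwoDimCoefficients` (stmt-ValiantsHypothesis-8062), stub `stub_dualUnipotent`:
# scaling-closure — INDEX-`n` PENCILS SATISFY `hdeg` (the degree hypothesis of the method)

Every conditional result of the scaling-closure method (✓ `exists_shadowFamily`, ✓ `sq_le_two_mul_of_torusUnstableCompanions`,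
✓ `rank_hess0_factor_le_of_dualUnipotent`, the factor programme of memo SEVENTEENTH-HAND.md) carries the hypothesis
**hdeg**: `deg D_k ≤ k·n` for `D_k = [X^k] det(X·B + A)`, `k ≥ 2`.  It is NOT automatic (decorated pencils violate it,
memo §B), but it holds on a natural class: pencils whose NUMERATOR `adj A` has degree `≤ n − 1`, in particular the
nilpotent-pencil normal forms `A = A₀(1 − N)` of INDEX `n` (`Nⁿ = 0`; all known representations — Grenet's,
IMM-projections — are of this kind):

* `totalDegree_coeff_prod_le_weight`, `totalDegree_coeff_charpolyRev_le` — coefficients of `det(1 − X·M′)` for a matrix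
  `M′` of polynomials of degree `≤ w` have degree `≤ k·w`;
* `det_X_smul_add_eq_C_mul_charpolyRev` — `det(X·B + A) = det A · det(1 + X·(det A)⁻¹ adj A·B)` (`det A` a unit);
* ★ `totalDegree_coeff_det_le_of_adjugate`, ★ `hdeg_of_adjugate` — `det A = c ≠ 0`, `B` affine,
  `deg adj A ≤ n − 1` ⟹ `deg D_k ≤ k·n` for all `k`, i.e. hdeg;
* ★ `totalDegree_adjugate_le_of_index`, ★ `hdeg_of_index` — `A = A₀(1 − N)`, `N` linear with `Nⁿ = 0`, `A₀` invertible ⟹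
  `adj A = c·(Σ_{j<n} N^j)·A₀⁻¹` has degree `≤ n − 1`, hence hdeg;
* `rank_hess0_factor_le_of_index` — sample discharge: the simple-factor Mignon–Ressayre bound of
  ✓ `rank_hess0_factor_le_of_dualUnipotent` for index-`n` representations, with no degree hypothesis left.

HONEST FRAMING: identifies the natural domain of a conditional method; the stub `DualUnipotentBound`, the crux and
`VP ≠ VNP` remain open.

References: folklore (`(1 − N)⁻¹ = Σ_{j<n} N^j` for `Nⁿ = 0`, L. G. Valiant, STOC 1979, §2).
-/

-- single-conjunct layout `Summits/ValiantsHypothesis/ValiantsHypothesis`: the duplicated namespace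
-- component is mandated by the tree.
set_option linter.dupNamespace false
set_option autoImplicit false

noncomputable section

namespace Summit.ValiantsHypothesis.ValiantsHypothesis.Theorems.GrenetZeonTwoDimCoefficients.ScalingClosure

open MvPolynomial Matrix
open Literature.Computability.AlgebraicComplexity
open Summit.ValiantsHypothesis.ValiantsHypothesis.Cruxes.TwoDimCoefficients.DimTwoCases

/-! ### Weighted degree of the coefficients of `det(1 − X·M′)` -/

section Weight

variable {σ : Type*} {ι : Type*} [DecidableEq ι]

/-- Coefficients of a product of polynomials in `X` whose `j`-th coefficients have degree `≤ j·w` have `k`-th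
coefficient of degree `≤ k·w`. [folklore] -/
theorem totalDegree_coeff_prod_le_weight (w : ℕ) (s : Finset ι) (p : ι → Polynomial (MvPolynomial σ ℂ))
    (hp : ∀ i ∈ s, ∀ j, ((p i).coeff j).totalDegree ≤ j * w) (k : ℕ) :
    ((∏ i ∈ s, p i).coeff k).totalDegree ≤ k * w := by
  induction s using Finset.induction_on generalizing k with
  | empty =>
    simp only [Finset.prod_empty, Polynomial.coeff_one]
    split_ifs
    · exact (totalDegree_one).le.trans (Nat.zero_le _)
    · exact (totalDegree_zero).le.trans (Nat.zero_le _)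
  | insert a s ha ih =>
    rw [Finset.prod_insert ha, Polynomial.coeff_mul]
    refine (totalDegree_finsetSum _ _).trans (Finset.sup_le fun x hx => ?_)
    refine (totalDegree_mul _ _).trans ?_
    have h1 := hp a (Finset.mem_insert_self a s) x.1
    have h2 := ih (fun i hi j => hp i (Finset.mem_insert_of_mem hi) j) x.2
    have hx' : x.1 + x.2 = k := Finset.HasAntidiagonal.mem_antidiagonal.mp hx
    calc ((p a).coeff x.1).totalDegree + ((∏ i ∈ s, p i).coeff x.2).totalDegree ≤ x.1 * w + x.2 * w :=
          Nat.add_le_add h1 h2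
      _ = k * w := by rw [← Nat.add_mul, hx']

variable [Fintype ι]

/-- **`deg [X^k] det(1 − X·M′) ≤ k·w`** for a matrix `M′` of polynomials of degree `≤ w`. [folklore] -/
theorem totalDegree_coeff_charpolyRev_le (M' : Matrix ι ι (MvPolynomial σ ℂ)) (w : ℕ)
    (hM : ∀ i j, (M' i j).totalDegree ≤ w) (k : ℕ) :
    ((M'.charpolyRev).coeff k).totalDegree ≤ k * w := by
  rw [Matrix.charpolyRev, det_apply', Polynomial.finsetSum_coeff]
  refine (totalDegree_finsetSum _ _).trans (Finset.sup_le fun τ _ => ?_)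
  rw [← map_intCast (Polynomial.C : MvPolynomial σ ℂ →+* Polynomial (MvPolynomial σ ℂ)), Polynomial.coeff_C_mul]
  refine (totalDegree_mul _ _).trans ?_
  rw [← map_intCast (MvPolynomial.C : ℂ →+* MvPolynomial σ ℂ), totalDegree_C, zero_add]
  refine totalDegree_coeff_prod_le_weight w Finset.univ
    (fun i => ((1 : Matrix ι ι (Polynomial (MvPolynomial σ ℂ))) -
      (Polynomial.X : Polynomial (MvPolynomial σ ℂ)) • M'.map Polynomial.C) (τ i) i) (fun i _ j => ?_) k
  rw [Matrix.sub_apply, Matrix.smul_apply, Matrix.map_apply, smul_eq_mul, mul_comm,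
    ← pow_one (Polynomial.X : Polynomial (MvPolynomial σ ℂ)), Polynomial.coeff_sub, Polynomial.coeff_C_mul_X_pow,
    Matrix.one_apply]
  refine (totalDegree_sub _ _).trans (max_le ?_ ?_)
  · -- the identity matrix: constants
    by_cases h : τ i = i
    · rw [if_pos h, Polynomial.coeff_one]
      split_ifs
      · exact (totalDegree_one).le.trans (Nat.zero_le _)
      · exact (totalDegree_zero).le.trans (Nat.zero_le _)
    · rw [if_neg h, Polynomial.coeff_zero]
      exact (totalDegree_zero).le.trans (Nat.zero_le _)
  · split_ifs with h1
    · subst h1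
      exact (hM _ _).trans (by omega)
    · exact (totalDegree_zero).le.trans (Nat.zero_le _)

end Weight

/-! ### `det(X·B + A)` through the numerator `adj A·B` -/

section Numerator

variable {R : Type*} [CommRing R] {ι : Type*} [Fintype ι] [DecidableEq ι]

/-- **`det(X·B + A) = det A · det(1 − X·(−v·adj A·B))`** for `det A · v = 1`. [folklore] -/
theorem det_X_smul_add_eq_C_mul_charpolyRev (A B : Matrix ι ι R) (v : R) (hv : A.det * v = 1) :
    det ((Polynomial.X : Polynomial R) • B.map Polynomial.C + A.map Polynomial.C) =
      Polynomial.C A.det * (-(v • (A.adjugate * B))).charpolyRev := by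
  set P := A.adjugate * B with hP
  have hAN : A * (v • P) = B := by
    rw [Matrix.mul_smul, hP, ← Matrix.mul_assoc, Matrix.mul_adjugate, Matrix.smul_mul, Matrix.one_mul,
      smul_smul, mul_comm v, hv, one_smul]
  have hfac : (Polynomial.X : Polynomial R) • B.map Polynomial.C + A.map Polynomial.C =
      A.map Polynomial.C * (1 - (Polynomial.X : Polynomial R) • (-(v • P)).map Polynomial.C) := by
    rw [Matrix.mul_sub, Matrix.mul_one, Matrix.mul_smul, ← Matrix.map_mul, Matrix.mul_neg, hAN,
      Matrix.map_neg _ (map_neg Polynomial.C), smul_neg, sub_neg_eq_add, add_comm]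
  rw [hfac, det_mul, Matrix.charpolyRev]
  congr 1
  rw [← RingHom.mapMatrix_apply, ← RingHom.map_det]

end Numerator

/-! ### hdeg from the degree of the numerator -/

section Hdeg

variable {σ : Type*} {ι : Type*} [Fintype ι] [DecidableEq ι]

/-- Entries of `adj A·B` have degree `≤ (deg adj A) + 1` for affine `B`. [folklore] -/
theorem totalDegree_adjugate_mul_le (A B : Matrix ι ι (MvPolynomial σ ℂ)) (w : ℕ)
    (hadj : ∀ i j, (A.adjugate i j).totalDegree ≤ w) (hB : ∀ i j, (B i j).totalDegree ≤ 1) (i j : ι) :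
    ((A.adjugate * B) i j).totalDegree ≤ w + 1 := by
  rw [Matrix.mul_apply]
  refine (totalDegree_finsetSum _ _).trans (Finset.sup_le fun l _ => ?_)
  exact (totalDegree_mul _ _).trans (Nat.add_le_add (hadj i l) (hB l j))

/-- ★ **`deg D_k ≤ k·n` from `deg adj A ≤ n − 1`.**  `det A = c ≠ 0`, `B` affine, every entry of `adj A` of degree
`≤ n − 1` (`n ≥ 1`) ⟹ `deg [X^k] det(X·B + A) ≤ k·n`. [folklore] -/
theorem totalDegree_coeff_det_le_of_adjugate {n : ℕ} (hn : 1 ≤ n) (A B : Matrix ι ι (MvPolynomial σ ℂ))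
    (hB : ∀ i j, (B i j).totalDegree ≤ 1) (c : ℂ) (hc : c ≠ 0) (hdet : A.det = MvPolynomial.C c)
    (hadj : ∀ i j, (A.adjugate i j).totalDegree ≤ n - 1) (k : ℕ) :
    ((det ((Polynomial.X : Polynomial (MvPolynomial σ ℂ)) • B.map Polynomial.C +
      A.map Polynomial.C)).coeff k).totalDegree ≤ k * n := by
  have hv : A.det * MvPolynomial.C c⁻¹ = 1 := by
    rw [hdet, ← map_mul, mul_inv_cancel₀ hc, map_one]
  rw [det_X_smul_add_eq_C_mul_charpolyRev A B _ hv, Polynomial.coeff_C_mul, hdet]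
  refine (totalDegree_mul _ _).trans ?_
  rw [totalDegree_C, zero_add]
  refine totalDegree_coeff_charpolyRev_le _ n (fun i j => ?_) k
  rw [Matrix.neg_apply, totalDegree_neg, Matrix.smul_apply, smul_eq_mul]
  refine (totalDegree_mul _ _).trans ?_
  rw [totalDegree_C, zero_add]
  exact (totalDegree_adjugate_mul_le A B (n - 1) hadj hB i j).trans (by omega)

/-- ★ **hdeg from the numerator degree**, in the exact shape consumed by the scaling-closure files
(`hdeg : ∀ k, 2 ≤ k → ∀ d, k·n < d → [D_k]_d = 0`). [folklore] -/
theorem hdeg_of_adjugate {n : ℕ} (hn : 1 ≤ n) (A B : Matrix ι ι (MvPolynomial σ ℂ))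
    (hB : ∀ i j, (B i j).totalDegree ≤ 1) (c : ℂ) (hc : c ≠ 0) (hdet : A.det = MvPolynomial.C c)
    (hadj : ∀ i j, (A.adjugate i j).totalDegree ≤ n - 1)
    (D : ℕ → MvPolynomial σ ℂ)
    (hD : ∀ k, D k = (det ((Polynomial.X : Polynomial (MvPolynomial σ ℂ)) • B.map Polynomial.C +
      A.map Polynomial.C)).coeff k) :
    ∀ k, 2 ≤ k → ∀ d, k * n < d → homogeneousComponent d (D k) = 0 := by
  intro k _ d hd
  rw [hD]
  exact homogeneousComponent_eq_zero _ _
    ((totalDegree_coeff_det_le_of_adjugate hn A B hB c hc hdet hadj k).trans_lt hd)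

end Hdeg

/-! ### Index-`n` normal forms -/

section Index

variable {σ : Type*} {m : ℕ}

/-- ★ **The numerator of an index-`n` pencil has degree `≤ n − 1`.**  `A = A₀·(1 − N)` with `A₀` invertible
(`A₀·P₀ = 1`), `N` a matrix of linear forms with `Nⁿ = 0`, `det A = c` ⟹ `adj A = c·(Σ_{j<n} N^j)·P₀` and every
entry of `adj A` has degree `≤ n − 1`. [folklore] -/
theorem totalDegree_adjugate_le_of_index {n : ℕ} (hn : 1 ≤ n) (A₀ P₀ : Matrix (Fin m) (Fin m) ℂ)
    (hP₀ : A₀ * P₀ = 1) (N : Matrix (Fin m) (Fin m) (MvPolynomial σ ℂ)) (hN : ∀ i j, (N i j).IsHomogeneous 1)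
    (hNn : N ^ n = 0) (A : Matrix (Fin m) (Fin m) (MvPolynomial σ ℂ))
    (hA : A = A₀.map MvPolynomial.C * (1 - N)) (c : ℂ) (hc : c ≠ 0) (hdet : A.det = MvPolynomial.C c)
    (i j : Fin m) : (A.adjugate i j).totalDegree ≤ n - 1 := by
  classical
  have hu : IsUnit A.det := by
    rw [hdet]
    exact (isUnit_iff_ne_zero.mpr hc).map MvPolynomial.C
  -- explicit inverse
  set Q : Matrix (Fin m) (Fin m) (MvPolynomial σ ℂ) :=
    (∑ l ∈ Finset.range n, N ^ l) * P₀.map MvPolynomial.C with hQ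
  have hAQ : A * Q = 1 := by
    rw [hA, hQ, Matrix.mul_assoc, ← Matrix.mul_assoc (1 - N), mul_neg_geom_sum, hNn, sub_zero,
      Matrix.one_mul, ← Matrix.map_mul, hP₀, Matrix.map_one _ (map_zero _) (map_one _)]
  have hadj : A.adjugate = (MvPolynomial.C c : MvPolynomial σ ℂ) • Q := by
    rw [adjugate_eq_det_smul_inv A hu, Matrix.inv_eq_right_inv hAQ, hdet]
  rw [hadj, Matrix.smul_apply, smul_eq_mul]
  refine (totalDegree_mul _ _).trans ?_
  rw [totalDegree_C, zero_add, hQ, Matrix.mul_apply]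
  refine (totalDegree_finsetSum _ _).trans (Finset.sup_le fun l _ => ?_)
  refine (totalDegree_mul _ _).trans ?_
  rw [Matrix.map_apply, totalDegree_C, add_zero, Matrix.sum_apply]
  refine (totalDegree_finsetSum _ _).trans (Finset.sup_le fun a ha => ?_)
  have h := (isHomogeneous_pow_apply hN a i l).totalDegree_le
  have ha' : a < n := Finset.mem_range.mp ha
  omega

/-- ★ **Index-`n` pencils satisfy hdeg.**  In the normal form `A = A₀(1 − N)`, `Nⁿ = 0`, `B` affine,
`det A = c ≠ 0`: `[D_k]_d = 0` for all `k` and all `d > k·n`. [folklore] -/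
theorem hdeg_of_index {n : ℕ} (hn : 1 ≤ n) (A₀ P₀ : Matrix (Fin m) (Fin m) ℂ) (hP₀ : A₀ * P₀ = 1)
    (N : Matrix (Fin m) (Fin m) (MvPolynomial σ ℂ)) (hN : ∀ i j, (N i j).IsHomogeneous 1) (hNn : N ^ n = 0)
    (A B : Matrix (Fin m) (Fin m) (MvPolynomial σ ℂ)) (hA : A = A₀.map MvPolynomial.C * (1 - N))
    (hB : ∀ i j, (B i j).totalDegree ≤ 1) (c : ℂ) (hc : c ≠ 0) (hdet : A.det = MvPolynomial.C c)
    (D : ℕ → MvPolynomial σ ℂ)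
    (hD : ∀ k, D k = (det ((Polynomial.X : Polynomial (MvPolynomial σ ℂ)) • B.map Polynomial.C +
      A.map Polynomial.C)).coeff k) :
    ∀ k, 2 ≤ k → ∀ d, k * n < d → homogeneousComponent d (D k) = 0 :=
  hdeg_of_adjugate hn A B hB c hc hdet
    (totalDegree_adjugate_le_of_index hn A₀ P₀ hP₀ N hN hNn A hA c hc hdet) D hD

/-- **Sample discharge: Mignon–Ressayre on simple shadow factors of an INDEX-`n` representation**, with no degree
hypothesis left (✓ `rank_hess0_factor_le_of_dualUnipotent` ∘ `hdeg_of_index`). [cite: MignonRessayre2004, Thm. 1.1 —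
via the tree; folklore] -/
theorem rank_hess0_factor_le_of_index {n m : ℕ} (A B : AffMat n m) (hA : IsAffine A) (hB : IsAffine B)
    (α β c : ℂ) (hc : c ≠ 0) (hβ : β ≠ 0) (hdet : A.det = MvPolynomial.C c)
    (hper : perPoly (Fin n) ℂ = MvPolynomial.C α * A.det + MvPolynomial.C β * (A.adjugate * B).trace)
    (hn : 1 ≤ n) (hm2 : 2 ≤ m)
    (A₀ P₀ : Matrix (Fin m) (Fin m) ℂ) (hP₀ : A₀ * P₀ = 1) (N : AffMat n m) (hN : ∀ i j, (N i j).IsHomogeneous 1)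
    (hNn : N ^ n = 0) (hAN : A = A₀.map MvPolynomial.C * (1 - N))
    (D : ℕ → MvPolynomial (Fin n × Fin n) ℂ)
    (hD : ∀ j, D j = (det ((Polynomial.X : Polynomial (MvPolynomial (Fin n × Fin n) ℂ)) •
      B.map Polynomial.C + A.map Polynomial.C)).coeff j)
    (G U : MvPolynomial (Fin n × Fin n) ℂ)
    (hfac : MvPolynomial.C c + MvPolynomial.C β⁻¹ * perPoly (Fin n) ℂ +
      (∑ j ∈ Finset.range (m + 1), if 2 ≤ j then homogeneousComponent (j * n) (D j) else 0) = G * U)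
    (z₀ : Fin n × Fin n → ℂ) (hG : eval z₀ G = 0) (hU : eval z₀ U ≠ 0) (i : Fin n × Fin n)
    (hi : eval z₀ (pderiv i G) ≠ 0) :
    (hess0 (transl z₀ G)).rank ≤ 2 * m + 2 :=
  rank_hess0_factor_le_of_dualUnipotent A B hA hB α β c hc hβ hdet hper hn hm2 D hD
    (hdeg_of_index hn A₀ P₀ hP₀ N hN hNn A B hAN hB c hc hdet D hD) G U hfac z₀ hG hU i hi

end Index

end Summit.ValiantsHypothesis.ValiantsHypothesis.Theorems.GrenetZeonTwoDimCoefficients.ScalingClosure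

end
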